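import Summits.QuantumFields.YangMills.Theorems.SwapVirialDeficitBlowUpGnomonicZSignLargeField
import Summits.QuantumFields.YangMills.Theorems.SwapVirialDeficitBlowUpGnomonicBaseFlat
import Summits.QuantumFields.YangMills.Theorems.SwapVirialDeficitBlowUpGnomonicBFibreJets
import Summits.QuantumFields.YangMills.Theorems.SwapVirialDeficitBlowUpChartDeficitGrowth
import Summits.QuantumFields.YangMills.Theorems.SwapVirialDeficitZeroModeGroupThreeScaling
import Summits.QuantumFields.YangMills.Theorems.SwapVirialDeficitSigmaTwistedLetterCeilingAlgebra
import Literature.MathematicalPhysics.QuantumLattice.SU2HaarSmallBall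
import HarnessLib

/-!
# THE RELATION QUATERNIONS OF THE GNOMONIC RING CHART: the five leader relations as explicit quaternions, and their LETTER FLOORS
# (first input of the GLOBAL B-TUBE FLOOR = far floor of stub `stub_B_stiff` on the capped tube `BTubeCap`; LEAD sfw-p2 g99 ruling 2026-08-31 20:48Z,
# free-hands support of ⟨stmt-QuantumFields-24197⟩ `SwapVirialDeficit.SwapGluedStiffness`)

In the principal gnomonic chart (✓`gnomonicPoint`, ✓`gnoDeficit`) at a hub `a ≠ 0` the four leaders read through `su2Quat` are (✓`su2Quat_gnoLeader_*`)
`C₀ = x̂ = ν(±(1,x))`, `C₁ = Ā·x̂·A·ẑ`, `C₂ = ŷ`, `c = A = ν(axisPoint a)` with the AXIAL hub unit `A = (re a, ‖im a‖, 0, 0)/‖a‖`.  The six σ-glued relations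
`[C₀,C₁], [C₀,C₂], [C₁,C₂], c·C₁ − C₀·c, c·C₀ − C₁·c, c·C₂ − C₂·c` are polynomial quaternions in the letters; this file computes what each one SEES:
* §0 quaternion bookkeeping (`(j,k)`-part `≤ ‖q‖²` via lit ✓`sq_norm_eq_sum_sq`, commutators of radial units, the `(j,k)`-components of a general commutator;
  the axial commutator norm is ✓`SigmaTwistedCeiling.norm_comm_axial_sq`, the axial norm ✓`ZeroModeGroup.norm_sq_axis`);
* §1 gnomonic letters: components, `‖±(1,v)‖² = 1 + |v|²`, ★ `|v|²/(1+|v|²) ≤ ‖ν(±(1,v)) − 1‖²` (SIGN-FREE: the imaginary part alone);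
* §2 axial quaternions: `‖p‖²`, `p²`, the conjugation `p̄·X·p` (a rotation of the `(j,k)`-plane by the doubled axial angle), ★ `|(j,k)-part of [X, p̄Xp]|² =
  16p₁²‖p‖²X_I²(X_J² + X_K²)`; the axial point `axisPoint a` and the hub `hubAt δ 1 = (δ, 1, 0, 0)`;
* §3 rescaling identities; §4 ★★ THE FIVE RELATION FLOORS at the quaternion level (every hub `a ≠ 0`, every sign, all letters; `u = (x₁,x₂)`):
  (σ2) `‖Aŷ − ŷA‖² = 4‖im a‖²|y⊥|²/(‖a‖²(1+|y|²))`; (c02) `4((x₂y₀−x₀y₂)² + (x₀y₁−x₁y₀)²)/((1+|x|²)(1+|y|²)) ≤ ‖x̂ŷ − ŷx̂‖²`;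
  (σ1) `A²x̂ − x̂A² = A·(s₁ + Āx̂A(ẑ−1)A)` so `‖A²x̂ − x̂A²‖ ≤ ‖s₁‖ + ‖ẑ − 1‖`, and `‖A²x̂ − x̂A²‖² = 16re(a)²‖im a‖²|u|²/(‖a‖⁴(1+|x|²))` (the HUB-POLAR
  letter is seen through the word `Ā[A², x̂]`); (c01) `‖x̂P − Px̂‖ ≤ ‖[x̂, Pẑ]‖ + 2‖ẑ − 1‖` (`P = Āx̂A`) and `16‖im a‖²x₀²|u|²/(‖a‖²(1+|x|²)²) ≤ ‖x̂P − Px̂‖²`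
  (the AXIAL TILT of the `x`-letter); (σ0) is ✓`norm_sigmaRel_zero_quat` (`‖cC₁ − C₀c‖ = ‖ẑ − 1‖`, δ-free: the slaving is built in).
The chart-level floors and the capped-tube far floor are the next two files (`…GnomonicLetterFloors`, `…BTubeCapFarFloor`).

HONEST LABEL: quaternion bookkeeping on landed inequalities; the B-tube law, stubs `stub_B_stiff` ∕ `stub_core_*` ∕ `stub_h001_good`, ⟨24197⟩ ∕ ⟨24194⟩
and every rung are OPEN; own crux ⟨22884⟩ `LargeFieldMassRefinementTail` OPEN (blocked-on ⟨19935⟩); no crux, rung of record or summit is proved; the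
Yang–Mills mass gap is NOT proved; no summit is proved by a line.  THEOREMS ONLY (0 `def`, 0 `sorry`), standard axioms.  Width seat ym-line-sfw-p2-w3 g67
(cell ym-idea-1, free hands), `--supports stmt-QuantumFields-24197`.  References: [cite: Luscher1983, §2]; [cite: tHooft1979]; [folklore].
-/

set_option autoImplicit false

noncomputable section

open MeasureTheory Quaternion
open scoped BigOperators Quaternion
open Literature.MathematicalPhysics.QuantumFieldTheory hiding SU2
open Literature.MathematicalPhysics.QuantumLattice
open Literature.Analysis.Calculus (radialUnit radialUnit_def norm_radialUnit)

namespace Summit.QuantumFields.YangMills.Theorems.SwapVirialDeficit.BlowUpRing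

open Summit.QuantumFields.YangMills.Theorems.FemtoTransferGap
open Summit.QuantumFields.YangMills.Theorems.FemtoTransferGap.TT
open Summit.QuantumFields.YangMills.Theorems.FemtoTransferGap.TwoLattice.Flat (fd)
open Summit.QuantumFields.YangMills.Theorems.VirialFluxGap.RingDeficit
open Summit.QuantumFields.YangMills.Theorems.SwapVirialDeficit.SwapRing
open Summit.QuantumFields.YangMills.Theorems.SwapTwistDeficit.ToronLog (axisPoint)
open Summit.QuantumFields.YangMills.Theorems.SwapVirialDeficit.ZeroModeSigma (norm_axisUnit su2Quat_quatToSU2_eq_radialUnit)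
open Summit.QuantumFields.YangMills.Theorems.ToronValleyVolume.Lojasiewicz (fd_sq_eq_two_mul)

variable {L : ℕ} [NeZero L]

/-! ## §0 Quaternion bookkeeping -/

omit [NeZero L] in
/-- The `(j,k)`-part is bounded by the norm: `imJ² + imK² ≤ ‖q‖²`. [folklore] -/
theorem bfar_imJK_le_norm_sq (q : ℍ) : q.imJ ^ 2 + q.imK ^ 2 ≤ ‖q‖ ^ 2 := by
  rw [sq_norm_eq_sum_sq]; nlinarith [sq_nonneg q.re, sq_nonneg q.imI]

omit [NeZero L] in
/-- The imaginary part is bounded by the norm: `imI² + imJ² + imK² ≤ ‖q‖²`. [folklore] -/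
theorem bfar_im_le_norm_sq (q : ℍ) : q.imI ^ 2 + q.imJ ^ 2 + q.imK ^ 2 ≤ ‖q‖ ^ 2 := by
  rw [sq_norm_eq_sum_sq]; nlinarith [sq_nonneg q.re]

omit [NeZero L] in
/-- `‖c • q‖² = c²·‖q‖²` for a real scalar. [folklore] -/
theorem bfar_norm_smul_sq (c : ℝ) (q : ℍ) : ‖c • q‖ ^ 2 = c ^ 2 * ‖q‖ ^ 2 := by
  rw [norm_smul, mul_pow, Real.norm_eq_abs, sq_abs]

omit [NeZero L] in
/-- The commutator of two radial units is the rescaled raw commutator: `ν(p)ν(q) − ν(q)ν(p) = (‖p‖⁻¹‖q‖⁻¹)·(pq − qp)`. [folklore] -/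
theorem bfar_radialUnit_comm (p q : ℍ) :
    radialUnit p * radialUnit q - radialUnit q * radialUnit p = (‖p‖⁻¹ * ‖q‖⁻¹) • (p * q - q * p) := by
  rw [radialUnit_def, radialUnit_def, smul_sub, smul_mul_assoc, mul_smul_comm, smul_smul, smul_mul_assoc, mul_smul_comm, smul_smul,
    mul_comm ‖q‖⁻¹ ‖p‖⁻¹]

omit [NeZero L] in
/-- The `(j,k)`-components of a general commutator: `(XY − YX)_J = 2(X_K Y_I − X_I Y_K)`, `(XY − YX)_K = 2(X_I Y_J − X_J Y_I)`. [folklore] -/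
theorem bfar_comm_imJK (X Y : ℍ) :
    (X * Y - Y * X).imJ = 2 * (X.imK * Y.imI - X.imI * Y.imK) ∧ (X * Y - Y * X).imK = 2 * (X.imI * Y.imJ - X.imJ * Y.imI) := by
  constructor <;> simp <;> ring

/-! ## §1 The gnomonic letters: components and norms -/

omit [NeZero L] in
/-- Components of a gnomonic letter `±(1, v)`. [folklore] -/
theorem bfar_gnoLetter_components (ε : Bool) (v : Fin 3 → ℝ) :
    (gnoLetter ε v).re = gnoSign ε ∧ (gnoLetter ε v).imI = gnoSign ε * v 0 ∧ (gnoLetter ε v).imJ = gnoSign ε * v 1 ∧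
      (gnoLetter ε v).imK = gnoSign ε * v 2 := by
  rw [gnoLetter_eq]
  refine ⟨?_, ?_, ?_, ?_⟩ <;> simp [gnomonicQuat]

omit [NeZero L] in
/-- `‖±(1, v)‖² = 1 + |v|²`. [folklore] -/
theorem bfar_norm_gnoLetter_sq (ε : Bool) (v : Fin 3 → ℝ) : ‖gnoLetter ε v‖ ^ 2 = 1 + ((v 0) ^ 2 + (v 1) ^ 2 + (v 2) ^ 2) := by
  obtain ⟨h0, h1, h2, h3⟩ := bfar_gnoLetter_components ε v
  have hs : gnoSign ε ^ 2 = 1 := gnoSign_sq ε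
  rw [sq_norm_eq_sum_sq, h0, h1, h2, h3]
  nlinarith [hs]

omit [NeZero L] in
/-- `0 < ‖±(1,v)‖`. [folklore] -/
theorem bfar_norm_gnoLetter_pos (ε : Bool) (v : Fin 3 → ℝ) : 0 < ‖gnoLetter ε v‖ := norm_pos_iff.2 (gnoLetter_ne_zero ε v)

omit [NeZero L] in
/-- The imaginary components of `ν(±(1,v)) − 1` are `‖(1,v)‖⁻¹·(±v_i)`. [folklore] -/
theorem bfar_radialUnit_gnoLetter_sub_one_im (ε : Bool) (v : Fin 3 → ℝ) :
    (radialUnit (gnoLetter ε v) - 1).imI = ‖gnoLetter ε v‖⁻¹ * (gnoSign ε * v 0) ∧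
    (radialUnit (gnoLetter ε v) - 1).imJ = ‖gnoLetter ε v‖⁻¹ * (gnoSign ε * v 1) ∧
    (radialUnit (gnoLetter ε v) - 1).imK = ‖gnoLetter ε v‖⁻¹ * (gnoSign ε * v 2) := by
  obtain ⟨-, h1, h2, h3⟩ := bfar_gnoLetter_components ε v
  refine ⟨?_, ?_, ?_⟩
  · simp [radialUnit_def, h1]
  · simp [radialUnit_def, h2]
  · simp [radialUnit_def, h3]

omit [NeZero L] in
/-- ★ SIGN-FREE: `|v|²/(1+|v|²) ≤ ‖ν(±(1,v)) − 1‖²` (the imaginary part alone). [folklore] -/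
theorem bfar_norm_radialUnit_gnoLetter_sub_one_sq_ge (ε : Bool) (v : Fin 3 → ℝ) :
    ((v 0) ^ 2 + (v 1) ^ 2 + (v 2) ^ 2) / (1 + ((v 0) ^ 2 + (v 1) ^ 2 + (v 2) ^ 2)) ≤ ‖radialUnit (gnoLetter ε v) - 1‖ ^ 2 := by
  obtain ⟨eI, eJ, eK⟩ := bfar_radialUnit_gnoLetter_sub_one_im ε v
  have hs : gnoSign ε ^ 2 = 1 := gnoSign_sq ε
  have hn2 := bfar_norm_gnoLetter_sq ε v
  have hNpos : 0 < ‖gnoLetter ε v‖ := bfar_norm_gnoLetter_pos ε v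
  have him := bfar_im_le_norm_sq (radialUnit (gnoLetter ε v) - 1)
  rw [eI, eJ, eK] at him
  have hsum : (‖gnoLetter ε v‖⁻¹ * (gnoSign ε * v 0)) ^ 2 + (‖gnoLetter ε v‖⁻¹ * (gnoSign ε * v 1)) ^ 2 +
      (‖gnoLetter ε v‖⁻¹ * (gnoSign ε * v 2)) ^ 2 = ((v 0) ^ 2 + (v 1) ^ 2 + (v 2) ^ 2) / (1 + ((v 0) ^ 2 + (v 1) ^ 2 + (v 2) ^ 2)) := by
    rw [← hn2]
    field_simp
    nlinarith [hs]
  linarith [hsum]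

/-! ## §2 Axial quaternions `p = (p₀, p₁, 0, 0)` (the hub unit `ν(axisPoint a)` is of this form): norm, square, conjugation -/

omit [NeZero L] in
/-- The square of an axial quaternion: `p² = (p₀² − p₁², 2p₀p₁, 0, 0)`. [folklore] -/
theorem bfar_axial_sq_components (p : ℍ) (hJ : p.imJ = 0) (hK : p.imK = 0) :
    (p * p).re = p.re ^ 2 - p.imI ^ 2 ∧ (p * p).imI = 2 * p.re * p.imI ∧ (p * p).imJ = 0 ∧ (p * p).imK = 0 := by
  refine ⟨?_, ?_, ?_, ?_⟩ <;> simp [hJ, hK] <;> ring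

omit [NeZero L] in
/-- Conjugation by an axial `p`: `p̄·X·p = ((p₀²+p₁²)X₀, (p₀²+p₁²)X_I, (p₀²−p₁²)X_J + 2p₀p₁X_K, (p₀²−p₁²)X_K − 2p₀p₁X_J)` (a rotation of the
`(j,k)`-plane by the doubled axial angle, times `‖p‖²`). [folklore] -/
theorem bfar_axialConj_components (p : ℍ) (hJ : p.imJ = 0) (hK : p.imK = 0) (X : ℍ) :
    (star p * X * p).re = (p.re ^ 2 + p.imI ^ 2) * X.re ∧ (star p * X * p).imI = (p.re ^ 2 + p.imI ^ 2) * X.imI ∧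
    (star p * X * p).imJ = (p.re ^ 2 - p.imI ^ 2) * X.imJ + 2 * p.re * p.imI * X.imK ∧
    (star p * X * p).imK = (p.re ^ 2 - p.imI ^ 2) * X.imK - 2 * p.re * p.imI * X.imJ := by
  refine ⟨?_, ?_, ?_, ?_⟩ <;> simp [hJ, hK] <;> ring

omit [NeZero L] in
/-- `|(j,k)-part of [X, p̄Xp]|² = 16·p₁²·‖p‖²·X_I²·(X_J² + X_K²)` for an axial `p`. [folklore] -/
theorem bfar_comm_axialConj_imJK_sq (p : ℍ) (hJ : p.imJ = 0) (hK : p.imK = 0) (X : ℍ) :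
    (X * (star p * X * p) - (star p * X * p) * X).imJ ^ 2 + (X * (star p * X * p) - (star p * X * p) * X).imK ^ 2 =
      16 * p.imI ^ 2 * (p.re ^ 2 + p.imI ^ 2) * X.imI ^ 2 * (X.imJ ^ 2 + X.imK ^ 2) := by
  obtain ⟨c0, c1, c2, c3⟩ := bfar_axialConj_components p hJ hK X
  obtain ⟨eJ, eK⟩ := bfar_comm_imJK X (star p * X * p)
  rw [eJ, eK, c1, c2, c3]; ring

omit [NeZero L] in
/-- `‖axisPoint a‖² = ‖a‖²` (`= re² + ‖im‖²`). [folklore] -/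
theorem bfar_norm_axisPoint_sq (a : ℍ) : ‖axisPoint a‖ ^ 2 = ‖a‖ ^ 2 := by
  rw [ZeroModeGroup.norm_sq_axis (axisPoint a) rfl rfl]
  show a.re ^ 2 + ‖a.im‖ ^ 2 = ‖a‖ ^ 2
  rw [sq_norm_eq_sum_sq a, sq_norm_eq_sum_sq a.im]
  simp only [Quaternion.re_im, Quaternion.imI_im, Quaternion.imJ_im, Quaternion.imK_im]
  ring

omit [NeZero L] in
/-- The hub `hubAt δ 1 = (δ, 1, 0, 0)`: `axisPoint (hubAt δ 1) = hubAt δ 1`, components and `‖·‖² = 1 + δ²`. [folklore] -/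
theorem bfar_hubAt_facts (δ : ℝ) :
    axisPoint (hubAt δ 1) = hubAt δ 1 ∧ (hubAt δ 1).re = δ ∧ (hubAt δ 1).imI = 1 ∧ ‖hubAt δ 1‖ ^ 2 = 1 + δ ^ 2 := by
  have h := norm_im_hubAt_one δ
  have h0 : (hubAt δ 1).re = δ := rfl
  have h1 : (hubAt δ 1).imI = 1 := by simp [hubAt]
  refine ⟨?_, h0, h1, ?_⟩
  · rw [axisPoint, h, h0]; ext <;> simp [hubAt]
  · rw [ZeroModeGroup.norm_sq_axis (hubAt δ 1) rfl rfl, h0, h1]; ring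

/-! ## §3 Scalar bookkeeping for rescaled products -/

omit [NeZero L] in
/-- `(c•X)(d•W) − (d•W)(c•X) = (cd)•(XW − WX)`. [folklore] -/
theorem bfar_comm_smul (c d : ℝ) (X W : ℍ) : (c • X) * (d • W) - (d • W) * (c • X) = (c * d) • (X * W - W * X) := by
  ext <;> simp <;> ring

omit [NeZero L] in
/-- `star (c•p)·(d•X)·(c•p) = (c·d·c)•(p̄Xp)` for real scalars. [folklore] -/
theorem bfar_conj_smul (c d : ℝ) (p X : ℍ) : star (c • p) * (d • X) * (c • p) = (c * d * c) • (star p * X * p) := by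
  ext <;> simp <;> ring

omit [NeZero L] in
/-- Squared components of a gnomonic letter are sign-free: `X_I² = x₀²`, `X_J² = x₁²`, `X_K² = x₂²`. [folklore] -/
theorem bfar_gnoLetter_sq_components (ε : Bool) (v : Fin 3 → ℝ) :
    (gnoLetter ε v).imI ^ 2 = (v 0) ^ 2 ∧ (gnoLetter ε v).imJ ^ 2 = (v 1) ^ 2 ∧ (gnoLetter ε v).imK ^ 2 = (v 2) ^ 2 := by
  obtain ⟨-, h1, h2, h3⟩ := bfar_gnoLetter_components ε v
  have hs : gnoSign ε ^ 2 = 1 := gnoSign_sq ε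
  refine ⟨?_, ?_, ?_⟩
  · rw [h1, mul_pow, hs, one_mul]
  · rw [h2, mul_pow, hs, one_mul]
  · rw [h3, mul_pow, hs, one_mul]

/-! ## §4 The five relation floors at the quaternion level (hub `a ≠ 0`, unit `A = ν(axisPoint a)`, letters `x̂ = ν(X)`, `ŷ = ν(Y)`, `ẑ = ν(Z)`) -/

omit [NeZero L] in
/-- ★ (σ2) **The seam–`C₂` relation sees the TRANSVERSE `y`-letters**: `‖A·ŷ − ŷ·A‖² = 4‖im a‖²(y₁² + y₂²)/(‖a‖²(1 + |y|²))`. [folklore] -/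
theorem bfar_sigmaRel_two_sq {a : ℍ} (ha : a ≠ 0) (ε : Bool) (y : Fin 3 → ℝ) :
    ‖radialUnit (axisPoint a) * radialUnit (gnoLetter ε y) - radialUnit (gnoLetter ε y) * radialUnit (axisPoint a)‖ ^ 2 =
      4 * ‖a.im‖ ^ 2 * ((y 1) ^ 2 + (y 2) ^ 2) / (‖a‖ ^ 2 * (1 + ((y 0) ^ 2 + (y 1) ^ 2 + (y 2) ^ 2))) := by
  rw [bfar_radialUnit_comm, bfar_norm_smul_sq, SigmaTwistedCeiling.norm_comm_axial_sq _ _ rfl rfl]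
  obtain ⟨-, hJ, hK⟩ := bfar_gnoLetter_sq_components ε y
  rw [hJ, hK, show (axisPoint a).imI = ‖a.im‖ from rfl, mul_pow, inv_pow, inv_pow, bfar_norm_axisPoint_sq, bfar_norm_gnoLetter_sq]
  have ha' : 0 < ‖a‖ ^ 2 := by positivity
  have hY : 0 < 1 + ((y 0) ^ 2 + (y 1) ^ 2 + (y 2) ^ 2) := by positivity
  field_simp

omit [NeZero L] in
/-- ★ (c02) **The `C₀`–`C₂` commutator sees the AXIAL `y`-letter against the transverse `x`-letters**:
`4((x₂y₀ − x₀y₂)² + (x₀y₁ − x₁y₀)²)/((1+|x|²)(1+|y|²)) ≤ ‖x̂·ŷ − ŷ·x̂‖²`. [folklore] -/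
theorem bfar_comm_zero_two_sq_ge (εx εy : Bool) (x y : Fin 3 → ℝ) :
    4 * ((x 2 * y 0 - x 0 * y 2) ^ 2 + (x 0 * y 1 - x 1 * y 0) ^ 2) /
        ((1 + ((x 0) ^ 2 + (x 1) ^ 2 + (x 2) ^ 2)) * (1 + ((y 0) ^ 2 + (y 1) ^ 2 + (y 2) ^ 2))) ≤
      ‖radialUnit (gnoLetter εx x) * radialUnit (gnoLetter εy y) - radialUnit (gnoLetter εy y) * radialUnit (gnoLetter εx x)‖ ^ 2 := by
  rw [bfar_radialUnit_comm, bfar_norm_smul_sq]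
  have him := bfar_imJK_le_norm_sq (gnoLetter εx x * gnoLetter εy y - gnoLetter εy y * gnoLetter εx x)
  obtain ⟨eJ, eK⟩ := bfar_comm_imJK (gnoLetter εx x) (gnoLetter εy y)
  obtain ⟨-, x1, x2, x3⟩ := bfar_gnoLetter_components εx x
  obtain ⟨-, y1, y2, y3⟩ := bfar_gnoLetter_components εy y
  have hsx : gnoSign εx ^ 2 = 1 := gnoSign_sq εx
  have hsy : gnoSign εy ^ 2 = 1 := gnoSign_sq εy
  rw [eJ, eK, x1, x2, x3, y1, y2, y3] at him
  have hX := bfar_norm_gnoLetter_sq εx x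
  have hY := bfar_norm_gnoLetter_sq εy y
  have hXpos : 0 < 1 + ((x 0) ^ 2 + (x 1) ^ 2 + (x 2) ^ 2) := by positivity
  have hYpos : 0 < 1 + ((y 0) ^ 2 + (y 1) ^ 2 + (y 2) ^ 2) := by positivity
  have key : (2 * (gnoSign εx * x 2 * (gnoSign εy * y 0) - gnoSign εx * x 0 * (gnoSign εy * y 2))) ^ 2 +
      (2 * (gnoSign εx * x 0 * (gnoSign εy * y 1) - gnoSign εx * x 1 * (gnoSign εy * y 0))) ^ 2 =
      4 * ((x 2 * y 0 - x 0 * y 2) ^ 2 + (x 0 * y 1 - x 1 * y 0) ^ 2) := by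
    have e1 : (2 * (gnoSign εx * x 2 * (gnoSign εy * y 0) - gnoSign εx * x 0 * (gnoSign εy * y 2))) ^ 2 =
        4 * (gnoSign εx ^ 2 * gnoSign εy ^ 2) * (x 2 * y 0 - x 0 * y 2) ^ 2 := by ring
    have e2 : (2 * (gnoSign εx * x 0 * (gnoSign εy * y 1) - gnoSign εx * x 1 * (gnoSign εy * y 0))) ^ 2 =
        4 * (gnoSign εx ^ 2 * gnoSign εy ^ 2) * (x 0 * y 1 - x 1 * y 0) ^ 2 := by ring
    rw [e1, e2, hsx, hsy]; ring
  rw [key] at him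
  rw [mul_pow, inv_pow, inv_pow, hX, hY, div_eq_mul_inv, mul_inv, mul_comm]
  have h0 : 0 ≤ (1 + ((x 0) ^ 2 + (x 1) ^ 2 + (x 2) ^ 2))⁻¹ * (1 + ((y 0) ^ 2 + (y 1) ^ 2 + (y 2) ^ 2))⁻¹ := by positivity
  exact mul_le_mul_of_nonneg_left him h0

omit [NeZero L] in
/-- ★ (σ1, algebra) `A²·x̂ − x̂·A² = A·(s₁ + Ā·x̂·A·(ẑ − 1)·A)` for a UNIT `A`, where `s₁ = A·x̂ − (Ā·x̂·A·ẑ)·A` is the `μ = 1` σ-relation defect. [folklore] -/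
theorem bfar_sigmaRel_one_identity {A : ℍ} (hA : ‖A‖ = 1) (xh zh : ℍ) :
    A * A * xh - xh * (A * A) = A * ((A * xh - star A * xh * A * zh * A) + star A * xh * A * (zh - 1) * A) := by
  have hAA : A * star A = 1 := by
    rw [Quaternion.self_mul_star, Quaternion.normSq_eq_norm_mul_self, hA, mul_one, Quaternion.coe_one]
  have e : A * ((A * xh - star A * xh * A * zh * A) + star A * xh * A * (zh - 1) * A) =
      A * A * xh - (A * star A) * xh * A * A := by noncomm_ring
  rw [e, hAA, one_mul, mul_assoc xh A A]

omit [NeZero L] in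
/-- ★ (σ1, norm) `‖A²x̂ − x̂A²‖ ≤ ‖s₁‖ + ‖ẑ − 1‖` for units `A`, `x̂`. [folklore] -/
theorem bfar_sigmaRel_one_norm_le {A xh : ℍ} (hA : ‖A‖ = 1) (hx : ‖xh‖ = 1) (zh : ℍ) :
    ‖A * A * xh - xh * (A * A)‖ ≤ ‖A * xh - star A * xh * A * zh * A‖ + ‖zh - 1‖ := by
  rw [bfar_sigmaRel_one_identity hA xh zh, norm_mul, hA, one_mul]
  refine (norm_add_le (A * xh - star A * xh * A * zh * A) (star A * xh * A * (zh - 1) * A)).trans ?_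
  have e : ‖star A * xh * A * (zh - 1) * A‖ = ‖zh - 1‖ := by
    rw [norm_mul, norm_mul, norm_mul, norm_mul, norm_star, hA, hx]; ring
  rw [e]

omit [NeZero L] in
/-- ★ (σ1, floor) **The second σ-relation sees the HUB-POLAR letter**: with `A = ν(axisPoint a)`, `x̂ = ν(±(1,x))`,
`‖A²x̂ − x̂A²‖² = 16·re(a)²·‖im a‖²·(x₁² + x₂²)/(‖a‖⁴(1+|x|²))` (`= 4 sin²2ψ·|u|²/(1+|x|²)`, `ψ` the hub angle). [folklore] -/
theorem bfar_sqComm_sq {a : ℍ} (ha : a ≠ 0) (ε : Bool) (x : Fin 3 → ℝ) :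
    ‖radialUnit (axisPoint a) * radialUnit (axisPoint a) * radialUnit (gnoLetter ε x) -
        radialUnit (gnoLetter ε x) * (radialUnit (axisPoint a) * radialUnit (axisPoint a))‖ ^ 2 =
      16 * a.re ^ 2 * ‖a.im‖ ^ 2 * ((x 1) ^ 2 + (x 2) ^ 2) / ((‖a‖ ^ 2) ^ 2 * (1 + ((x 0) ^ 2 + (x 1) ^ 2 + (x 2) ^ 2))) := by
  have eAA : radialUnit (axisPoint a) * radialUnit (axisPoint a) = (‖axisPoint a‖⁻¹ * ‖axisPoint a‖⁻¹) • (axisPoint a * axisPoint a) := by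
    rw [radialUnit_def, smul_mul_assoc, mul_smul_comm, smul_smul]
  rw [eAA, radialUnit_def (gnoLetter ε x)]
  rw [show ((‖axisPoint a‖⁻¹ * ‖axisPoint a‖⁻¹) • (axisPoint a * axisPoint a)) * (‖gnoLetter ε x‖⁻¹ • gnoLetter ε x) -
      (‖gnoLetter ε x‖⁻¹ • gnoLetter ε x) * ((‖axisPoint a‖⁻¹ * ‖axisPoint a‖⁻¹) • (axisPoint a * axisPoint a)) =
      ((‖axisPoint a‖⁻¹ * ‖axisPoint a‖⁻¹) * ‖gnoLetter ε x‖⁻¹) • ((axisPoint a * axisPoint a) * gnoLetter ε x -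
        gnoLetter ε x * (axisPoint a * axisPoint a)) from bfar_comm_smul _ _ _ _]
  obtain ⟨-, pI, pJ, pK⟩ := bfar_axial_sq_components (axisPoint a) rfl rfl
  rw [bfar_norm_smul_sq, SigmaTwistedCeiling.norm_comm_axial_sq _ _ pJ pK, pI]
  obtain ⟨-, hJ, hK⟩ := bfar_gnoLetter_sq_components ε x
  rw [hJ, hK, show (axisPoint a).imI = ‖a.im‖ from rfl, show (axisPoint a).re = a.re from rfl, mul_pow, mul_pow, inv_pow, inv_pow,
    bfar_norm_axisPoint_sq, bfar_norm_gnoLetter_sq]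
  have ha' : 0 < ‖a‖ ^ 2 := by positivity
  have hX : 0 < 1 + ((x 0) ^ 2 + (x 1) ^ 2 + (x 2) ^ 2) := by positivity
  field_simp
  ring

omit [NeZero L] in
/-- ★ (c01, algebra) `x̂P − Px̂ = (x̂·(Pẑ) − (Pẑ)·x̂) − x̂·P·(ẑ − 1) + P·(ẑ − 1)·x̂` (`P = Ā·x̂·A`). [folklore] -/
theorem bfar_comm_zero_one_identity (xh P zh : ℍ) :
    xh * P - P * xh = (xh * (P * zh) - P * zh * xh) - xh * P * (zh - 1) + P * (zh - 1) * xh := by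
  noncomm_ring

omit [NeZero L] in
/-- ★ (c01, norm) `‖x̂P − Px̂‖ ≤ ‖x̂·(Pẑ) − (Pẑ)·x̂‖ + 2‖ẑ − 1‖` for units `x̂`, `P`. [folklore] -/
theorem bfar_comm_zero_one_norm_le {xh P : ℍ} (hx : ‖xh‖ = 1) (hP : ‖P‖ = 1) (zh : ℍ) :
    ‖xh * P - P * xh‖ ≤ ‖xh * (P * zh) - P * zh * xh‖ + 2 * ‖zh - 1‖ := by
  rw [bfar_comm_zero_one_identity xh P zh]
  have h1 : ‖xh * (P * zh) - P * zh * xh - xh * P * (zh - 1) + P * (zh - 1) * xh‖ ≤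
      ‖xh * (P * zh) - P * zh * xh - xh * P * (zh - 1)‖ + ‖P * (zh - 1) * xh‖ := norm_add_le _ _
  have h2 : ‖xh * (P * zh) - P * zh * xh - xh * P * (zh - 1)‖ ≤ ‖xh * (P * zh) - P * zh * xh‖ + ‖xh * P * (zh - 1)‖ := norm_sub_le _ _
  have e1 : ‖xh * P * (zh - 1)‖ = ‖zh - 1‖ := by rw [norm_mul, norm_mul, hx, hP]; ring
  have e2 : ‖P * (zh - 1) * xh‖ = ‖zh - 1‖ := by rw [norm_mul, norm_mul, hx, hP]; ring
  linarith

omit [NeZero L] in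
/-- ★ (c01, floor) **The `C₀`–`C₁` commutator sees the AXIAL TILT of the `x`-letter**: with `x̂ = ν(±(1,x))`, `P = Ā·x̂·A`,
`16‖im a‖²·x₀²·(x₁² + x₂²)/(‖a‖²(1+|x|²)²) ≤ ‖x̂P − Px̂‖²`. [folklore] -/
theorem bfar_comm_conj_sq_ge {a : ℍ} (ha : a ≠ 0) (ε : Bool) (x : Fin 3 → ℝ) :
    16 * ‖a.im‖ ^ 2 * (x 0) ^ 2 * ((x 1) ^ 2 + (x 2) ^ 2) / (‖a‖ ^ 2 * (1 + ((x 0) ^ 2 + (x 1) ^ 2 + (x 2) ^ 2)) ^ 2) ≤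
      ‖radialUnit (gnoLetter ε x) * (star (radialUnit (axisPoint a)) * radialUnit (gnoLetter ε x) * radialUnit (axisPoint a)) -
        (star (radialUnit (axisPoint a)) * radialUnit (gnoLetter ε x) * radialUnit (axisPoint a)) * radialUnit (gnoLetter ε x)‖ ^ 2 := by
  have eP : star (radialUnit (axisPoint a)) * radialUnit (gnoLetter ε x) * radialUnit (axisPoint a) =
      (‖axisPoint a‖⁻¹ * ‖gnoLetter ε x‖⁻¹ * ‖axisPoint a‖⁻¹) • (star (axisPoint a) * gnoLetter ε x * axisPoint a) := by
    rw [radialUnit_def, radialUnit_def]; exact bfar_conj_smul _ _ _ _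
  rw [eP, radialUnit_def (gnoLetter ε x), bfar_comm_smul, bfar_norm_smul_sq]
  have him := bfar_imJK_le_norm_sq (gnoLetter ε x * (star (axisPoint a) * gnoLetter ε x * axisPoint a) -
    (star (axisPoint a) * gnoLetter ε x * axisPoint a) * gnoLetter ε x)
  rw [bfar_comm_axialConj_imJK_sq (axisPoint a) rfl rfl (gnoLetter ε x), ← ZeroModeGroup.norm_sq_axis (axisPoint a) rfl rfl] at him
  obtain ⟨hI, hJ, hK⟩ := bfar_gnoLetter_sq_components ε x
  have hp2 : ‖axisPoint a‖ ^ 2 = ‖a‖ ^ 2 := bfar_norm_axisPoint_sq a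
  rw [hI, hJ, hK, show (axisPoint a).imI = ‖a.im‖ from rfl, hp2] at him
  have hX2 : ‖gnoLetter ε x‖ ^ 2 = 1 + ((x 0) ^ 2 + (x 1) ^ 2 + (x 2) ^ 2) := bfar_norm_gnoLetter_sq ε x
  have ha' : 0 < ‖a‖ := norm_pos_iff.2 ha
  have hXpos : 0 < ‖gnoLetter ε x‖ := bfar_norm_gnoLetter_pos ε x
  have hppos : 0 < ‖axisPoint a‖ := by nlinarith [norm_nonneg (axisPoint a), hp2, ha']
  have hsc : (‖gnoLetter ε x‖⁻¹ * (‖axisPoint a‖⁻¹ * ‖gnoLetter ε x‖⁻¹ * ‖axisPoint a‖⁻¹)) ^ 2 =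
      ((‖a‖ ^ 2) ^ 2 * (‖gnoLetter ε x‖ ^ 2) ^ 2)⁻¹ := by
    rw [← hp2]; field_simp
  have key : 16 * ‖a.im‖ ^ 2 * (x 0) ^ 2 * ((x 1) ^ 2 + (x 2) ^ 2) / (‖a‖ ^ 2 * (1 + ((x 0) ^ 2 + (x 1) ^ 2 + (x 2) ^ 2)) ^ 2) =
      ((‖a‖ ^ 2) ^ 2 * (‖gnoLetter ε x‖ ^ 2) ^ 2)⁻¹ * (16 * ‖a.im‖ ^ 2 * ‖a‖ ^ 2 * (x 0) ^ 2 * ((x 1) ^ 2 + (x 2) ^ 2)) := by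
    rw [← hX2]; field_simp
  rw [hsc, key]
  exact mul_le_mul_of_nonneg_left him (by positivity)

end Summit.QuantumFields.YangMills.Theorems.SwapVirialDeficit.BlowUpRing

end
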